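import Summits.CriticalPhenomena.PercolationContinuityZ3.Theorems.PercNearOneGluingNoHeavyLowerTailGuardedLonelyRelay
import Summits.CriticalPhenomena.PercolationContinuityZ3.Theorems.PercNearOneGluingNoHeavyLowerTailCILSmall
import HarnessLib

/-!
# `NoHeavyLowerTail` (stmt-CriticalPhenomena-4575) — the cumulative isolation lemma for `|A| ≤ 4`

The registered stub `stub_cumulativeIsolation` (CIL: for every level `j` some relay `a ∈ A` has
`P(1 ≤ N ≤ j) ≤ P(|π(a)| ≤ j)`, `π(v) = C(v) ∩ A`, `N = |π(o)|`) closes the crux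
(`Theorems.noHeavyLowerTail_of_stub_cumulativeIsolation`).  `…CILSmall` proves it for `|A| ≤ 3`; this file
proves it for `|A| = 4`, where the only new level is `j = 2` (`cumulativeIsolation_four_level_two`):

Take `y` maximising `h(x) := P(Π = (A∖x | x))` (relay partition: `x` isolated, the other three glued), and let
`L = {1 ≤ N ≤ 2}`, `R = {|π(y)| ≤ 2}`.  On `L ∖ R` the block of `y` holds `≥ 3` of the four relays and is
disjoint from the (nonempty, small) block of `o`, so `π(o) = {x}` and `Π = (A∖x | x)` for some `x ≠ y`:
`L ∖ R ⊆ ⋃_{x ≠ y} G_x`, `G_x = {o ↔ x} ∩ {x ↮ A∖x} ∩ {A∖x pairwise joined}`.  By the guarded lonely relay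
lemma (`Theorems.guardedLonelyRelay`, KN Lemma 1(ii)+2, guards `Q_x = {A∖x pairwise joined}`):
`Σ_{x∈A} μ(G_x) ≤ max_x h(x) = h(y)`, while `{Π = (A∖y|y)} ∖ G_y ⊆ R ∖ L` (there `N ∈ {0, 3}`).  Hence
`μ(L ∖ R) ≤ h(y) − μ(G_y) ≤ μ(R ∖ L)` and `μ(L) ≤ μ(R)`.

* `cumulativeIsolation_card_le_four` — the stub signature with the extra hypothesis `A.card ≤ 4`.
-/

noncomputable section

namespace Summit.CriticalPhenomena.PercolationContinuityZ3.Theorems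

open scoped BigOperators Classical
open MeasureTheory Set
open Literature.Probability.LatticeModels (prodBernoulli)
open Literature.Probability.Percolation

variable {n : ℕ}

namespace CILFour

/-- On `{1 ≤ N ≤ 2} ∖ {|π(y)| ≤ 2}` with `|A| = 4`: `π(o) = {x}` and `Π = (A∖x | x)` for some `x ∈ A`,
`x ≠ y`. [folklore] -/
theorem diff_subset (A : Finset (Fin n)) (hA4 : A.card = 4) (o y : Fin n) (hy : y ∈ A) :
    ({ω : BondConfig (Fin n) | 1 ≤ (A.filter fun a => ω ∈ openConn o a).card ∧
        (A.filter fun a => ω ∈ openConn o a).card ≤ 2} \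
      {ω : BondConfig (Fin n) | (A.filter fun a => ω ∈ openConn y a).card ≤ 2}) ⊆
      ⋃ x ∈ A.erase y, (openConn o x ∩ {ω | ∀ t ∈ A.erase x, ω ∉ openConn x t} ∩ {ω | ∀ t ∈ (↑(A.erase x) : Set (Fin n)), ∀ t' ∈ (↑(A.erase x) : Set (Fin n)), ω ∈ openConn t t'}) := by
  intro ω hω
  simp only [mem_sdiff, mem_setOf_eq, not_le] at hω
  obtain ⟨⟨h1, h2⟩, h3⟩ := hω
  set So := A.filter fun a => ω ∈ (openConn o a : Set (BondConfig (Fin n))) with hSo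
  set Sy := A.filter fun a => ω ∈ (openConn y a : Set (BondConfig (Fin n))) with hSy
  -- the two blocks are disjoint
  have hdisj : Disjoint So Sy := by
    rw [Finset.disjoint_left]
    intro a hao hay
    have hoa : (openGraph ω).Reachable o a := (Finset.mem_filter.1 hao).2
    have hya : (openGraph ω).Reachable y a := (Finset.mem_filter.1 hay).2
    have hoy : (openGraph ω).Reachable o y := hoa.trans hya.symm
    have heq : So = Sy := by
      refine Finset.filter_congr fun a _ => ⟨fun h => ?_, fun h => ?_⟩
      · exact hoy.symm.trans h
      · exact hoy.trans h
    rw [heq] at h2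
    omega
  have hsum : So.card + Sy.card ≤ 4 := by
    rw [← Finset.card_union_of_disjoint hdisj, ← hA4]
    exact Finset.card_le_card (Finset.union_subset (Finset.filter_subset _ _) (Finset.filter_subset _ _))
  have hSo1 : So.card = 1 := by omega
  have hSy3 : Sy.card = 3 := by omega
  obtain ⟨x, hx⟩ := Finset.card_eq_one.1 hSo1
  have hxSo : x ∈ So := by rw [hx]; exact Finset.mem_singleton_self x
  obtain ⟨hxA, hox⟩ := Finset.mem_filter.1 hxSo
  have hox' : (openGraph ω).Reachable o x := hox
  have hxSy : x ∉ Sy := fun h => Finset.disjoint_left.1 hdisj hxSo h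
  have hySy : y ∈ Sy := Finset.mem_filter.2 ⟨hy, (SimpleGraph.Reachable.refl y : (openGraph ω).Reachable y y)⟩
  have hxy : x ≠ y := fun h => hxSy (h ▸ hySy)
  -- `Sy = A.erase x`
  have hSysub : Sy ⊆ A.erase x := fun a ha =>
    Finset.mem_erase.2 ⟨fun h => hxSy (h ▸ ha), (Finset.mem_filter.1 ha).1⟩
  have hSyeq : Sy = A.erase x :=
    Finset.eq_of_subset_of_card_le hSysub (by rw [Finset.card_erase_of_mem hxA, hA4, hSy3])
  refine mem_iUnion₂.2 ⟨x, Finset.mem_erase.2 ⟨hxy, hxA⟩, ⟨hox, fun t ht hxt => ?_⟩, fun t ht t' ht' => ?_⟩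
  · -- `x ↮ t`: otherwise `o ↔ t` and `t ∈ So = {x}`
    obtain ⟨htx, htA⟩ := Finset.mem_erase.1 ht
    have hxt' : (openGraph ω).Reachable x t := hxt
    have : t ∈ So := Finset.mem_filter.2 ⟨htA, hox'.trans hxt'⟩
    rw [hx] at this
    exact htx (Finset.mem_singleton.1 this)
  · -- `t ↔ t'` through `y`
    rw [Finset.mem_coe, ← hSyeq] at ht ht'
    have hyt : (openGraph ω).Reachable y t := (Finset.mem_filter.1 ht).2
    have hyt' : (openGraph ω).Reachable y t' := (Finset.mem_filter.1 ht').2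
    exact hyt.symm.trans hyt'

/-- `{Π = (A∖y|y)} ∖ G_y ⊆ {|π(y)| ≤ 2} ∖ {1 ≤ N ≤ 2}` (with `|A| = 4`, `y ∈ A`): on `D_y` the block of `y`
is `{y}`, and if `o ↮ y` while the other three relays are glued then `N ∈ {0, 3}`. [folklore] -/
theorem core_subset (A : Finset (Fin n)) (hA4 : A.card = 4) (o y : Fin n) (hy : y ∈ A) :
    ({ω | ∀ t ∈ A.erase y, ω ∉ openConn y t} ∩ {ω | ∀ t ∈ (↑(A.erase y) : Set (Fin n)), ∀ t' ∈ (↑(A.erase y) : Set (Fin n)), ω ∈ openConn t t'}) \ (openConn o y ∩ {ω | ∀ t ∈ A.erase y, ω ∉ openConn y t} ∩ {ω | ∀ t ∈ (↑(A.erase y) : Set (Fin n)), ∀ t' ∈ (↑(A.erase y) : Set (Fin n)), ω ∈ openConn t t'}) ⊆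
      {ω : BondConfig (Fin n) | (A.filter fun a => ω ∈ openConn y a).card ≤ 2} \
        {ω : BondConfig (Fin n) | 1 ≤ (A.filter fun a => ω ∈ openConn o a).card ∧
          (A.filter fun a => ω ∈ openConn o a).card ≤ 2} := by
  intro ω hω
  simp only [mem_sdiff, mem_inter_iff, mem_setOf_eq] at hω ⊢
  obtain ⟨⟨hD, hQ⟩, hG⟩ := hω
  have hoy : ω ∉ (openConn o y : Set (BondConfig (Fin n))) := fun h => hG ⟨⟨h, hD⟩, hQ⟩
  constructor
  · -- `π(y) = {y}`
    have : (A.filter fun a => ω ∈ (openConn y a : Set (BondConfig (Fin n)))) ⊆ {y} := by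
      intro a ha
      obtain ⟨haA, hya⟩ := Finset.mem_filter.1 ha
      by_contra hne
      rw [Finset.mem_singleton] at hne
      exact hD a (Finset.mem_erase.2 ⟨hne, haA⟩) hya
    exact (Finset.card_le_card this).trans (by simp)
  · -- `N ∈ {0, 3}`
    rintro ⟨h1, h2⟩
    obtain ⟨b, hb⟩ := Finset.card_pos.1 h1
    obtain ⟨hbA, hob⟩ := Finset.mem_filter.1 hb
    have hob' : (openGraph ω).Reachable o b := hob
    have hby : b ≠ y := fun h => hoy (h ▸ hob)
    have hb' : b ∈ (↑(A.erase y) : Set (Fin n)) := Finset.mem_coe.2 (Finset.mem_erase.2 ⟨hby, hbA⟩)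
    -- every relay other than `y` is joined to `o` through `b`
    have hsub : A.erase y ⊆ A.filter fun a => ω ∈ (openConn o a : Set (BondConfig (Fin n))) := by
      intro t ht
      have ht' : t ∈ (↑(A.erase y) : Set (Fin n)) := Finset.mem_coe.2 ht
      have hbt : (openGraph ω).Reachable b t := hQ b hb' t ht'
      exact Finset.mem_filter.2 ⟨(Finset.mem_erase.1 ht).2, hob'.trans hbt⟩
    have := Finset.card_le_card hsub
    rw [Finset.card_erase_of_mem hy, hA4] at this
    omega

end CILFour

open CILFour in
/-- **CIL at level 2 for four relays.**  For `A.card = 4` there is a relay `y ∈ A` with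
`P(1 ≤ N ≤ 2) ≤ P(|π(y)| ≤ 2)` — namely any maximiser of `P(Π = (A∖y | y))`.
[cite: KozmaNitzan2024, Lemmas 1–2 (pp. 5–6) — via Theorems.guardedLonelyRelay] -/
theorem cumulativeIsolation_four_level_two (w : Sym2 (Fin n) → unitInterval) (A : Finset (Fin n))
    (hA4 : A.card = 4) (o : Fin n) :
    ∃ y ∈ A, (prodBernoulli w).real {ω : BondConfig (Fin n) |
        1 ≤ (A.filter fun x => ω ∈ openConn o x).card ∧ (A.filter fun x => ω ∈ openConn o x).card ≤ 2} ≤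
      (prodBernoulli w).real {ω : BondConfig (Fin n) | (A.filter fun x => ω ∈ openConn y x).card ≤ 2} := by
  set μ := prodBernoulli w with hμ
  have hA : A.Nonempty := Finset.card_pos.1 (by omega)
  obtain ⟨y, hy, hmax⟩ := Finset.exists_max_image A (fun x => μ.real ({ω | ∀ t ∈ A.erase x, ω ∉ openConn x t} ∩ {ω | ∀ t ∈ (↑(A.erase x) : Set (Fin n)), ∀ t' ∈ (↑(A.erase x) : Set (Fin n)), ω ∈ openConn t t'})) hA
  refine ⟨y, hy, ?_⟩
  set L : Set (BondConfig (Fin n)) := {ω | 1 ≤ (A.filter fun x => ω ∈ openConn o x).card ∧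
    (A.filter fun x => ω ∈ openConn o x).card ≤ 2} with hL
  set R : Set (BondConfig (Fin n)) := {ω | (A.filter fun x => ω ∈ openConn y x).card ≤ 2} with hR
  -- the guarded lonely relay lemma with guards `Q_x = {A∖x pairwise joined}`
  have hsum : ∑ x ∈ A, μ.real (openConn o x ∩ {ω | ∀ t ∈ A.erase x, ω ∉ openConn x t} ∩ {ω | ∀ t ∈ (↑(A.erase x) : Set (Fin n)), ∀ t' ∈ (↑(A.erase x) : Set (Fin n)), ω ∈ openConn t t'}) ≤ μ.real ({ω | ∀ t ∈ A.erase y, ω ∉ openConn y t} ∩ {ω | ∀ t ∈ (↑(A.erase y) : Set (Fin n)), ∀ t' ∈ (↑(A.erase y) : Set (Fin n)), ω ∈ openConn t t'}) :=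
    guardedLonelyRelay w A o (fun x => {ω | ∀ t ∈ (↑(A.erase x) : Set (Fin n)), ∀ t' ∈ (↑(A.erase x) : Set (Fin n)), ω ∈ openConn t t'})
      (fun x _ => ⟨_, GuardedLonelyRelay.connAllFn_monotone _,
        GuardedLonelyRelay.connAllFn_biUnion_openEdgeCluster _⟩)
      _ measureReal_nonneg (fun x hx => hmax x hx)
  -- `μ(L \ R) ≤ Σ_{x ≠ y} μ(G_x)`
  have hLR : μ.real (L \ R) ≤ ∑ x ∈ A.erase y, μ.real (openConn o x ∩ {ω | ∀ t ∈ A.erase x, ω ∉ openConn x t} ∩ {ω | ∀ t ∈ (↑(A.erase x) : Set (Fin n)), ∀ t' ∈ (↑(A.erase x) : Set (Fin n)), ω ∈ openConn t t'}) :=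
    (measureReal_mono (diff_subset A hA4 o y hy) (measure_ne_top _ _)).trans
      (measureReal_biUnion_finset_le _ _)
  -- `μ(H_y) - μ(G_y) ≤ μ(R \ L)`
  have hRL : μ.real ({ω | ∀ t ∈ A.erase y, ω ∉ openConn y t} ∩ {ω | ∀ t ∈ (↑(A.erase y) : Set (Fin n)), ∀ t' ∈ (↑(A.erase y) : Set (Fin n)), ω ∈ openConn t t'}) - μ.real (openConn o y ∩ {ω | ∀ t ∈ A.erase y, ω ∉ openConn y t} ∩ {ω | ∀ t ∈ (↑(A.erase y) : Set (Fin n)), ∀ t' ∈ (↑(A.erase y) : Set (Fin n)), ω ∈ openConn t t'}) ≤ μ.real (R \ L) := by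
    have hGsub : (openConn o y ∩ {ω | ∀ t ∈ A.erase y, ω ∉ openConn y t} ∩ {ω | ∀ t ∈ (↑(A.erase y) : Set (Fin n)), ∀ t' ∈ (↑(A.erase y) : Set (Fin n)), ω ∈ openConn t t'} : Set (BondConfig (Fin n))) ⊆ {ω | ∀ t ∈ A.erase y, ω ∉ openConn y t} ∩ {ω | ∀ t ∈ (↑(A.erase y) : Set (Fin n)), ∀ t' ∈ (↑(A.erase y) : Set (Fin n)), ω ∈ openConn t t'} :=
      fun ω hω => ⟨hω.1.2, hω.2⟩
    have e : μ.real (({ω | ∀ t ∈ A.erase y, ω ∉ openConn y t} ∩ {ω | ∀ t ∈ (↑(A.erase y) : Set (Fin n)), ∀ t' ∈ (↑(A.erase y) : Set (Fin n)), ω ∈ openConn t t'}) \ (openConn o y ∩ {ω | ∀ t ∈ A.erase y, ω ∉ openConn y t} ∩ {ω | ∀ t ∈ (↑(A.erase y) : Set (Fin n)), ∀ t' ∈ (↑(A.erase y) : Set (Fin n)), ω ∈ openConn t t'})) =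
        μ.real ({ω | ∀ t ∈ A.erase y, ω ∉ openConn y t} ∩ {ω | ∀ t ∈ (↑(A.erase y) : Set (Fin n)), ∀ t' ∈ (↑(A.erase y) : Set (Fin n)), ω ∈ openConn t t'}) - μ.real (openConn o y ∩ {ω | ∀ t ∈ A.erase y, ω ∉ openConn y t} ∩ {ω | ∀ t ∈ (↑(A.erase y) : Set (Fin n)), ∀ t' ∈ (↑(A.erase y) : Set (Fin n)), ω ∈ openConn t t'}) :=
      measureReal_sdiff hGsub MeasurableSet.of_discrete
    rw [← e]
    exact measureReal_mono (core_subset A hA4 o y hy)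
  have hsplit : ∑ x ∈ A, μ.real (openConn o x ∩ {ω | ∀ t ∈ A.erase x, ω ∉ openConn x t} ∩ {ω | ∀ t ∈ (↑(A.erase x) : Set (Fin n)), ∀ t' ∈ (↑(A.erase x) : Set (Fin n)), ω ∈ openConn t t'}) =
      ∑ x ∈ A.erase y, μ.real (openConn o x ∩ {ω | ∀ t ∈ A.erase x, ω ∉ openConn x t} ∩ {ω | ∀ t ∈ (↑(A.erase x) : Set (Fin n)), ∀ t' ∈ (↑(A.erase x) : Set (Fin n)), ω ∈ openConn t t'}) +
        μ.real (openConn o y ∩ {ω | ∀ t ∈ A.erase y, ω ∉ openConn y t} ∩ {ω | ∀ t ∈ (↑(A.erase y) : Set (Fin n)), ∀ t' ∈ (↑(A.erase y) : Set (Fin n)), ω ∈ openConn t t'}) := by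
    rw [← Finset.sum_erase_add _ _ hy]
  have hL_eq : μ.real L = μ.real (L ∩ R) + μ.real (L \ R) :=
    (measureReal_inter_add_sdiff (μ := μ) (s := L) (t := R) MeasurableSet.of_discrete).symm
  have hR_eq : μ.real R = μ.real (R ∩ L) + μ.real (R \ L) :=
    (measureReal_inter_add_sdiff (μ := μ) (s := R) (t := L) MeasurableSet.of_discrete).symm
  rw [hL_eq, hR_eq, inter_comm R L]
  linarith

/-- **CIL for at most four relays, every level** — the registered signature of `stub_cumulativeIsolation`
with the extra hypothesis `A.card ≤ 4` (`|A| ≤ 3`: `…CILSmall`; `|A| = 4`: levels 0 (empty), 1 (lonely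
relay), 2 (`cumulativeIsolation_four_level_two`), `≥ 3` (extreme)). -/
theorem cumulativeIsolation_card_le_four :
    ∀ (n : ℕ) (w : Sym2 (Fin n) → unitInterval) (A : Finset (Fin n)) (o : Fin n) (j : ℕ),
      A.card ≤ 4 → A.Nonempty → o ∉ A → ∃ a ∈ A,
        (Literature.Probability.LatticeModels.prodBernoulli w).real
            {ω : Literature.Probability.Percolation.BondConfig (Fin n) |
              1 ≤ (A.filter fun x => ω ∈ Literature.Probability.Percolation.openConn o x).card ∧
                (A.filter fun x => ω ∈ Literature.Probability.Percolation.openConn o x).card ≤ j} ≤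
          (Literature.Probability.LatticeModels.prodBernoulli w).real
            {ω : Literature.Probability.Percolation.BondConfig (Fin n) |
              (A.filter fun x => ω ∈ Literature.Probability.Percolation.openConn a x).card ≤ j} := by
  intro n w A o j hA4 hA ho
  rcases Nat.lt_or_ge A.card 4 with h3 | h4
  · exact cumulativeIsolation_card_le_three n w A o j (by omega) hA ho
  · have hA4' : A.card = 4 := le_antisymm hA4 h4
    rcases Nat.lt_or_ge j 1 with hj0 | hj1
    · obtain ⟨a, ha⟩ := hA
      refine ⟨a, ha, ?_⟩
      have hempty : {ω : BondConfig (Fin n) |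
          1 ≤ (A.filter fun x => ω ∈ openConn o x).card ∧
            (A.filter fun x => ω ∈ openConn o x).card ≤ j} = ∅ := by
        ext ω; simp only [mem_setOf_eq, mem_empty_iff_false, iff_false]; omega
      rw [hempty, measureReal_empty]
      exact measureReal_nonneg
    rcases Nat.lt_or_ge j 2 with hj2 | hj2
    · have hj : j = 1 := by omega
      subst hj
      exact cumulativeIsolation_level_one w A o hA
    rcases Nat.lt_or_ge j 3 with hj3 | hj3
    · have hj : j = 2 := by omega
      subst hj
      exact cumulativeIsolation_four_level_two w A hA4' o
    · obtain ⟨a, ha⟩ := hA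
      exact ⟨a, ha, cumulativeIsolation_level_ge w A o a j (by omega)⟩

end Summit.CriticalPhenomena.PercolationContinuityZ3.Theorems

end
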